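import Literature.Combinatorics.Optimization.ShellLawGeneratingPolynomial
import Literature.Combinatorics.Optimization.ShellLawWeightedPointwiseMixture
import Literature.Probability.Distributions.TrinomialLineSection
import Literature.Probability.Distributions.TrinomialLineSectionBrackets
import HarnessLib

/-!
# The number of `HH` edges of a fully matched cut, given the block statistic, follows the line section

Bridge between the shell-law vocabulary of cell pnp-psdrank (`ShellLawLevelStep`,
`ShellLawGeneratingPolynomial`: a perfect matching as a fixed-point-free involution `π`, a `π`-stable ground
set `S` of `H`-type `(a, b, d)` = numbers of `HH`, mixed and `NN` edges, the level-`0` shell `Shell_S(2s, 0)` of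
fully matched cuts `W` = unions of `s` edges, the block statistic `|W ∩ H|`) and the line section of the
trivariate hypergeometric law (`TrinomialLineSection.lineW`):

* `card_filter_shellIn_zero_hh_eq_lineW` — `#{W ∈ Shell_S(2s,0) : |W ∩ H| = x, n_A(W) = α} = lineW a b d s x α`,
  where `n_A(W) = |reps(W ∩ vAA_S(H))|` is the number of `HH` edges inside `W` (a full `HH` edge scores `2`, a
  full mixed edge `1`: `|W ∩ H| = 2α + β`, `level_zero_bookkeeping`);
* `shellCount_zero_eq_sum_lineW` — summing over `α`: `Sh_S(2s, 0; x) = Σ_{α ≤ s} lineW a b d s x α`;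
* (v2) `lineW_cast_eq_choose_mul_coeff_hyperGen`, `card_filter_shellIn_zero_hh_eq_choose_mul_coeff_hyperGen` —
  the `x`-sections of the joint weight are hypergeometric rows: `lineW a b d s x α = C(a,α)·coeff_{x−2α} H_{b,d,s−α}`
  (so `HypergeometricRatioWindow` controls the `x`-direction of the joint law, `TrinomialLineSection` §5–§8 the
  `α`-direction).

* (v3) **all levels** — `sum_filter_shellIn_weight_eq_sum_halfSets_lineW`: for every weight `g` on the `HH` count,
  `Σ_{U ∈ Shell_S(c+2s,c), |U∩H| = x} g(n_A(U)) = Σ_{Y ∈ halfSets(S,c), |Y∩H| ≤ x} Σ_{α ≤ s} g(α)·lineW(a_Y,b_Y,d_Y; s, x−|Y∩H|; α)`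
  (the half-set decomposition `ShellLawWeightedPointwiseMixture.sum_shellIn_eq_sum_halfSets` of prover g27 + the
  level-`0` bridge on the stripped ground set `S ∖ (Y ∪ πY)` of type `(a_Y,b_Y,d_Y)`): the conditional law of `n_A`
  given the block statistic at ANY level is a mixture of line sections; and **`centredSq_section_ge_of_lineW_floor`**:
  a per-component variance floor valid for EVERY real centre (`TrinomialLineSection.var_lineW_ge_closed` /
  `_of_bracket`) passes to the mixture with no law of total variance —
  `c_V·#{U ∈ Shell_S(c+2s,c) : |U∩H| = x} ≤ Σ_{U : |U∩H| = x} (n_A(U) − m)²` (prover MEMO-30 (B3b): the input (V)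
  `A^m_{S,1}(x) ≥ c_V·law_S(2s+1,1;x)` of brick 130, at level `1` and at every level);
* (v4) **`centredSq_section_ge_of_brackets`** — the same with the component floors DISCHARGED by
  `TrinomialLineSection.var_lineW_ge_of_bracket`: per-component mode brackets + margins (`16L(L+1) ≤ M`,
  `4r+2 ≤ L+1`) ⇒ `(r²/2)·#{U : |U∩H| = x} ≤ Σ_{U : |U∩H| = x} (n_A(U) − m)²` for every real `m`;
* (v5) **`centredSq_section_ge_of_linearBrackets`** — the same from the LINEAR bracket conditions of
  `TrinomialLineSectionBrackets.var_lineW_ge_of_linearBracket` (three + three linear inequalities per component in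
  place of the cubic sign conditions);
* (v6) **`centredSq_section_ge_of_window`** — the same FROM THE WINDOW: per component, the real window
  `|x' − s(2a_Y+b_Y)/N_Y| ≤ ε` and six product margins `C·N_Y ≤ s·a_Y, a_Y(N_Y−s), …` (`C = M + 2L + 3ε + 7`)
  via `TrinomialLineSectionBrackets.var_lineW_ge_of_window`;
* (v6) **`centredSq_section_ge_of_window_one`** — LEVEL 1 from the GLOBAL data: `H`-type `(a,b,d)` of `S`, the
  cell's window `|x − (2s+1)(2a+b)/(2N)| ≤ ε₀` and six global product margins `C·(N−1) ≤ s·(a−1), (a−1)(N−1−s), …`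
  (`C = M + 2L + 3(ε₀+4) + 7`); the component windows are the global one `+ 4` (`strip_one_types`).
* (v7) **`centredSq_law_ge_of_window_one`** — the previous one on `S = univ` DIVIDED BY THE SHELL SIZE: `(r²/2)·law(2s+1,1;x)
  ≤ (Σ_{|U∩H| = x} (n_A(U) − m)²)/|Shell(2s+1,1)|`, the literal `hV` hypothesis of the Summits-side assembly (bricks 137/139).
* (v8) **`centredSq_law_ge_of_typeMargins`** (`…_shellIn`, `…'`) — TURNKEY: a REAL radius `ρ ≥ 0`, a REAL window
  `|x − (2s+1)(2a+b)/(2N₀)| ≤ ε`, `β(N₀−1) ≤ s ≤ (1−β)(N₀−1)` and `256(ρ+2)² + 3ε + 3 ≤ β(min(a,b,d) − 1)` (or, in the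
  cell's standard currency `a,b,d ≥ βN₀+1`, `βN₀ ≤ s ≤ (4+β)N₀/8`, `β ≤ 1/4`: the single condition
  `256(ρ+2)² + 3ε + 3 ≤ β²N₀`) give `(ρ²/2)·law(2s+1,1;x) ≤ A^m_1(x)` — no integer side conditions left.
* (v9) `typeMargins_smallness_of_scale` / `sqrt_half_sq_radius` — the smallness condition in the scale `N₀ = P⁸`
  (`ρ = √2(β/32)P⁴`, any window `ε ≤ c_ε P⁷`, `P ≥ P*`) and `√(ρ²/2) = (β/32)P⁴`;
* (v10) `centredSq_law_ge_of_scale` (`…_shellIn`), `half_sq_radius_eq` — (V) with `cV = (β/32)²·P⁸` literally.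

So at level `0` the conditional law of `n_A` given `|W ∩ H| = x` is `α ↦ lineW a b d s x α / Sh_S(2s,0;x)`:
log-concave in `α` (`lineW_mul_lineW_le_sq`), with the exact `s`-tilt and `α`-ratio of `TrinomialLineSection`
— the input «law of n_A given (X, level, half-data) is the LINE SECTION» of prover MEMO-28 §3c (after pinning
the half-edge data the remaining full edges form a level-`0` cut of the reduced ground set).
All PROVED, no definitions, no named facts.

## References
* [Rothvoss2017] T. Rothvoß, J. ACM 64 (2017), §2 (PDF pp. 5–6): cuts, matchings, the three edge types.
* [ChattamvelliShanmugam2020] R. Chattamvelli, R. Shanmugam, *Discrete Distributions in Engineering and the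
  Applied Sciences* (2020), §7.4 (PDF p. 144): the multivariate hypergeometric law.
* [VatutinMikhailov1983] V. A. Vatutin, V. G. Mikhailov, Theory Probab. Appl. 27 (1983) 734–743, §2 (the
  hypergeometric law as a subset count; the tree's `hyperGen`).
-/

noncomputable section

open Finset

namespace Literature.Combinatorics.Optimization

namespace ShellStep

open Literature.Probability.Distributions.TrinomialLineSection

variable {n : ℕ} {π : Fin n → Fin n} (hπ : ∀ v, π (π v) = v) (hπ' : ∀ v, π v ≠ v)
include hπ hπ'

/-- **The `HH` count of a fully matched cut given the block statistic is a line section**: for a `π`-stable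
`S` with `a = |reps vAA|` `HH` edges, `b = |reps(vBH ∪ vBN)|` mixed edges and `d = |reps vDD|` `NN` edges
w.r.t. `H`, and all `s, x, α`:
`#{W ∈ Shell_S(2s, 0) : |W ∩ H| = x ∧ |reps(W ∩ vAA)| = α} = lineW a b d s x α = C(a,α)·C(b,x−2α)·C(d,s+α−x)`.
[cite: Rothvoss2017, §2 (PDF p. 6)] [cite: ChattamvelliShanmugam2020, §7.4 (PDF p. 144)] -/
theorem card_filter_shellIn_zero_hh_eq_lineW {S : Finset (Fin n)} (hS : ∀ v ∈ S, π v ∈ S)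
    (H : Finset (Fin n)) (s x α : ℕ) :
    ((shellIn π S (2 * s) 0).filter fun W =>
        (W ∩ H).card = x ∧ (reps π (W ∩ vAA π S H)).card = α).card =
      lineW (reps π (vAA π S H)).card (reps π (vBH π S H ∪ vBN π S H)).card (reps π (vDD π S H)).card
        s x α := by
  classical
  by_cases h : 2 * α ≤ x ∧ x ≤ s + α
  · obtain ⟨h1, h2⟩ := h
    have e : s + α - x = s - α - (x - 2 * α) := by omega
    rw [lineW_of_le h1 h2, e, mul_assoc, ← card_shellIn_zero_typeClass hπ hπ' hS H (s := s) (α := α)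
      (β := x - 2 * α) (by omega)]
    congr 1
    refine filter_congr fun W hW => ?_
    have hb := level_zero_bookkeeping hπ hπ' hS H hW
    constructor
    · rintro ⟨hx, hα⟩
      exact ⟨hα, by omega⟩
    · rintro ⟨hα, hβ⟩
      exact ⟨by omega, hα⟩
  · have h0 : lineW (reps π (vAA π S H)).card (reps π (vBH π S H ∪ vBN π S H)).card
        (reps π (vDD π S H)).card s x α = 0 := by
      rw [not_and_or] at h
      rcases h with h | h
      · exact lineW_eq_zero_of_lt (by omega)
      · exact lineW_eq_zero_of_lt' (by omega)
    rw [h0, card_eq_zero, filter_eq_empty_iff]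
    rintro W hW ⟨hx, hα⟩
    have hb := level_zero_bookkeeping hπ hπ' hS H hW
    apply h
    constructor <;> omega

/-- **The level-`0` shell count as a sum of line-section weights**:
`Sh_S(2s, 0; x) = Σ_{α ≤ s} lineW a b d s x α` (classify the fully matched cuts with `|W ∩ H| = x` by their
number `α ≤ s` of `HH` edges). Hence the conditional law of the `HH` count given `|W ∩ H| = x` is
`lineW a b d s x α / Sh_S(2s,0;x)`. [cite: Rothvoss2017, §2 (PDF p. 6)] -/
theorem shellCount_zero_eq_sum_lineW {S : Finset (Fin n)} (hS : ∀ v ∈ S, π v ∈ S) (H : Finset (Fin n))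
    (s x : ℕ) :
    shellCount π S H (2 * s) 0 (x : ℤ) =
      ∑ α ∈ range (s + 1), (lineW (reps π (vAA π S H)).card (reps π (vBH π S H ∪ vBN π S H)).card
        (reps π (vDD π S H)).card s x α : ℝ) := by
  classical
  unfold shellCount
  have e : ((shellIn π S (2 * s) 0).filter fun U => ((U ∩ H).card : ℤ) = (x : ℤ)) =
      (shellIn π S (2 * s) 0).filter fun U => (U ∩ H).card = x :=
    filter_congr fun U _ => by exact_mod_cast Iff.rfl
  rw [e, card_eq_sum_card_fiberwise (f := fun W => (reps π (W ∩ vAA π S H)).card) (t := range (s + 1))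
    (fun W hW => by
      simp only [mem_coe, mem_filter] at hW
      have hb := level_zero_bookkeeping hπ hπ' hS H hW.1
      simp only [mem_coe, mem_range]
      omega)]
  push_cast
  refine sum_congr rfl fun α _ => ?_
  rw [filter_filter, card_filter_shellIn_zero_hh_eq_lineW hπ hπ' hS H s x α]

omit hπ hπ' in
/-- **The `x`-sections of the line section are hypergeometric rows.** For `α ≤ s` and `2α ≤ x`:
`lineW a b d s x α = C(a,α) · coeff_{x−2α} H_{b,d,s−α}` — at fixed `HH` count `α` the remaining `s − α` full
edges are drawn from the `b` mixed and `d` empty ones, and the block statistic minus `2α` is their number `j` of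
mixed edges, a hypergeometric variable with generating polynomial `hyperGen b d (s−α)` (both sides vanish for
`x > s + α`). So in the `x`-direction the window ratio bounds, envelopes and window lower bound of
`Probability/Distributions/HypergeometricRatioWindow.lean` apply to the joint weight `(x, α) ↦ lineW a b d s x α`
verbatim (mean `2α + (s−α)b/(b+d)`), while `TrinomialLineSection` §5–§8 control the `α`-direction.
[cite: ChattamvelliShanmugam2020, §7.4 (PDF p. 144)] [cite: VatutinMikhailov1983, §2] -/
theorem lineW_cast_eq_choose_mul_coeff_hyperGen (a b d s x α : ℕ) (hα : α ≤ s) (h : 2 * α ≤ x) :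
    (lineW a b d s x α : ℝ) =
      (a.choose α : ℝ) * (Literature.Combinatorics.StablePolynomials.hyperGen b d (s - α)).coeff (x - 2 * α) := by
  rw [Literature.Combinatorics.StablePolynomials.coeff_hyperGen]
  by_cases h2 : x ≤ s + α
  · rw [lineW_of_le h h2, if_pos (by omega : x - 2 * α ≤ s - α)]
    have e : s - α - (x - 2 * α) = s + α - x := by omega
    rw [e]; push_cast; ring
  · rw [lineW_eq_zero_of_lt' (by omega : s + α < x), if_neg (by omega : ¬ (x - 2 * α ≤ s - α))]
    simp

/-- **The joint level-`0` count is `C(a,α)` times a hypergeometric coefficient**: for `2α ≤ x`,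
`#{W ∈ Shell_S(2s,0) : |W ∩ H| = x ∧ n_A(W) = α} = C(a,α)·coeff_{x−2α} H_{b,d,s−α}` (with the type read off
`S` and `H`; `α ≤ s`). [cite: Rothvoss2017, §2 (PDF p. 6)] [cite: VatutinMikhailov1983, §2] -/
theorem card_filter_shellIn_zero_hh_eq_choose_mul_coeff_hyperGen {S : Finset (Fin n)}
    (hS : ∀ v ∈ S, π v ∈ S) (H : Finset (Fin n)) (s x α : ℕ) (hα : α ≤ s) (h : 2 * α ≤ x) :
    (((shellIn π S (2 * s) 0).filter fun W =>
        (W ∩ H).card = x ∧ (reps π (W ∩ vAA π S H)).card = α).card : ℝ) =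
      ((reps π (vAA π S H)).card.choose α : ℝ) *
        (Literature.Combinatorics.StablePolynomials.hyperGen (reps π (vBH π S H ∪ vBN π S H)).card
          (reps π (vDD π S H)).card (s - α)).coeff (x - 2 * α) := by
  rw [card_filter_shellIn_zero_hh_eq_lineW hπ hπ' hS H s x α, lineW_cast_eq_choose_mul_coeff_hyperGen _ _ _ _ _ _ hα h]

/-! ### §3 (v3) All levels: the weighted sections of the `HH` count decompose over the half-sets into line
sections; a centre-free component floor passes to the mixture -/

/-- In a fully matched cut of size `2s` the number of `HH` edges is at most `s`.
[cite: Rothvoss2017, §2 (PDF p. 6)] -/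
theorem hhCount_le_of_mem_shellIn_zero {S : Finset (Fin n)} (hS : ∀ v ∈ S, π v ∈ S) (H : Finset (Fin n))
    {s : ℕ} {W : Finset (Fin n)} (hW : W ∈ shellIn π S (2 * s) 0) :
    (reps π (W ∩ vAA π S H)).card ≤ s := by
  have hb := level_zero_bookkeeping hπ hπ' hS H hW
  omega

/-- **The weighted sections of `n_A` at any level are mixtures of line sections.** For a `π`-stable `S`, a
block `H`, a level `c`, `s` full edges (cut size `c + 2s`), a block statistic value `x` and ANY weight `g` on the
number `n_A(U) = #{v ∈ reps(vAA_π(S,H)) : v, πv ∈ U}` of `HH` edges inside the cut: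
`Σ_{U ∈ Shell_S(c+2s,c), |U∩H| = x} g(n_A(U)) = Σ_{Y ∈ halfSets(S,c)} [|Y∩H| ≤ x]·Σ_{α ≤ s} g(α)·lineW(a_Y, b_Y, d_Y; s, x − |Y∩H|; α)`,
where `(a_Y, b_Y, d_Y)` is the `H`-type of the stripped ground set `S ∖ (Y ∪ πY)`. (Group by the half-set `Y`;
on the fibre `n_A(W ∪ Y) = n_A^{S∖(Y∪πY)}(W)` and `|(W∪Y)∩H| = |W∩H| + |Y∩H|`; then the level-`0` bridge
`card_filter_shellIn_zero_hh_eq_lineW` on the stripped ground set.)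
[cite: Rothvoss2017, §2 (PDF p. 6)] [cite: ChattamvelliShanmugam2020, §7.4 (PDF p. 144)] -/
theorem sum_filter_shellIn_weight_eq_sum_halfSets_lineW {S : Finset (Fin n)} (hS : ∀ v ∈ S, π v ∈ S)
    (H : Finset (Fin n)) (g : ℕ → ℝ) (c s x : ℕ) :
    ∑ U ∈ (shellIn π S (c + 2 * s) c).filter (fun U => (U ∩ H).card = x),
        g ((reps π (vAA π S H)).filter fun v => v ∈ U ∧ π v ∈ U).card =
      ∑ Y ∈ halfSets π S c,
        if (Y ∩ H).card ≤ x then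
          ∑ α ∈ range (s + 1), g α *
            (lineW (reps π (vAA π (strip π S Y) H)).card
              (reps π (vBH π (strip π S Y) H ∪ vBN π (strip π S Y) H)).card
              (reps π (vDD π (strip π S Y) H)).card s (x - (Y ∩ H).card) α : ℝ)
        else 0 := by
  classical
  rw [sum_filter, sum_shellIn_eq_sum_halfSets hπ
    (F := fun U => if (U ∩ H).card = x then
      g ((reps π (vAA π S H)).filter fun v => v ∈ U ∧ π v ∈ U).card else 0) (by omega : c ≤ c + 2 * s)]
  have e : c + 2 * s - c = 2 * s := by omega
  rw [e]
  refine sum_congr rfl fun Y hY => ?_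
  have hst : ∀ v ∈ strip π S Y, π v ∈ strip π S Y := strip_stable hπ hS
  -- rewrite the summand on the fibre over `Y`
  have step : ∀ W ∈ shellIn π (strip π S Y) (2 * s) 0,
      (if ((W ∪ Y) ∩ H).card = x then
          g (((reps π (vAA π S H)).filter fun v => v ∈ W ∪ Y ∧ π v ∈ W ∪ Y).card) else 0) =
        if (W ∩ H).card + (Y ∩ H).card = x then g ((reps π (W ∩ vAA π (strip π S Y) H)).card) else 0 := by
    intro W hW
    rw [card_union_inter_eq hπ H hW, hhCount_union_eq hπ H hY hW]
  rw [sum_congr rfl step]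
  split_ifs with hx
  · rw [← sum_filter]
    have ef : ((shellIn π (strip π S Y) (2 * s) 0).filter fun W => (W ∩ H).card + (Y ∩ H).card = x) =
        (shellIn π (strip π S Y) (2 * s) 0).filter fun W => (W ∩ H).card = x - (Y ∩ H).card :=
      filter_congr fun W _ => by omega
    rw [ef]
    -- fiberwise over the `HH` count `α ≤ s`
    rw [← sum_fiberwise_of_maps_to (g := fun W => (reps π (W ∩ vAA π (strip π S Y) H)).card)
      (t := range (s + 1)) (fun W hW => by
        rw [mem_filter] at hW
        exact mem_range.2 (Nat.lt_succ_of_le (hhCount_le_of_mem_shellIn_zero hπ hπ' hst H hW.1)))]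
    refine sum_congr rfl fun α _ => ?_
    rw [filter_filter]
    have inner : ∑ W ∈ (shellIn π (strip π S Y) (2 * s) 0).filter
        (fun W => (W ∩ H).card = x - (Y ∩ H).card ∧ (reps π (W ∩ vAA π (strip π S Y) H)).card = α),
        g ((reps π (W ∩ vAA π (strip π S Y) H)).card) =
      ∑ W ∈ (shellIn π (strip π S Y) (2 * s) 0).filter
        (fun W => (W ∩ H).card = x - (Y ∩ H).card ∧ (reps π (W ∩ vAA π (strip π S Y) H)).card = α),
        g α := sum_congr rfl fun W hW => by rw [(mem_filter.1 hW).2.2]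
    rw [inner, sum_const, nsmul_eq_mul, mul_comm,
      card_filter_shellIn_zero_hh_eq_lineW hπ hπ' hst H s (x - (Y ∩ H).card) α]
  · exact sum_eq_zero fun W _ => by rw [if_neg (by omega)]

/-- **A centre-free component floor passes to the mixture (B3b).** If for every half-set `Y` of `S` of size
`c` with `|Y∩H| ≤ x` the line section of the stripped ground set at offset `x − |Y∩H|` has second moment about
`m` at least `c_V` times its mass — `c_V·Σ_{α≤s} lineW(a_Y,b_Y,d_Y; s, x−|Y∩H|; α) ≤ Σ_{α≤s} (α − m)²·lineW(…; α)`,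
e.g. by `TrinomialLineSection.var_lineW_ge_closed` / `var_lineW_ge_of_bracket`, valid for EVERY real centre —
then at level `c`: `c_V·#{U ∈ Shell_S(c+2s,c) : |U∩H| = x} ≤ Σ_{U ∈ Shell_S(c+2s,c), |U∩H| = x} (n_A(U) − m)²`.
With `m = E[n_A | X = x]` this is the variance floor (V) `A^m_{S,c}(x) ≥ c_V·law_S(c+2s,c;x)` of prover brick 130;
no law of total variance is needed since the component floor does not see the centre.
[cite: Rothvoss2017, §2 (PDF p. 6)] [cite: ChattamvelliShanmugam2020, §7.4 (PDF p. 144)] -/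
theorem centredSq_section_ge_of_lineW_floor {S : Finset (Fin n)} (hS : ∀ v ∈ S, π v ∈ S)
    (H : Finset (Fin n)) (c s x : ℕ) (cV m : ℝ)
    (hfloor : ∀ Y ∈ halfSets π S c, (Y ∩ H).card ≤ x →
      cV * ∑ α ∈ range (s + 1),
          (lineW (reps π (vAA π (strip π S Y) H)).card
            (reps π (vBH π (strip π S Y) H ∪ vBN π (strip π S Y) H)).card
            (reps π (vDD π (strip π S Y) H)).card s (x - (Y ∩ H).card) α : ℝ) ≤
        ∑ α ∈ range (s + 1), ((α : ℝ) - m) ^ 2 *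
          (lineW (reps π (vAA π (strip π S Y) H)).card
            (reps π (vBH π (strip π S Y) H ∪ vBN π (strip π S Y) H)).card
            (reps π (vDD π (strip π S Y) H)).card s (x - (Y ∩ H).card) α : ℝ)) :
    cV * (((shellIn π S (c + 2 * s) c).filter fun U => (U ∩ H).card = x).card : ℝ) ≤
      ∑ U ∈ (shellIn π S (c + 2 * s) c).filter (fun U => (U ∩ H).card = x),
        ((((reps π (vAA π S H)).filter fun v => v ∈ U ∧ π v ∈ U).card : ℝ) - m) ^ 2 := by
  classical
  have h1 := sum_filter_shellIn_weight_eq_sum_halfSets_lineW hπ hπ' hS H (fun _ => (1 : ℝ)) c s x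
  have h2 := sum_filter_shellIn_weight_eq_sum_halfSets_lineW hπ hπ' hS H (fun α => ((α : ℝ) - m) ^ 2) c s x
  simp only [sum_const, nsmul_eq_mul, mul_one, one_mul] at h1
  rw [h1, h2, mul_sum]
  refine sum_le_sum fun Y hY => ?_
  split_ifs with hx
  · exact hfloor Y hY hx
  · simp

/-! ### §4 (v4) The variance floor (V) in shell currency, assembled from the line-section brackets -/

/-- **(V) assembled (B3b + B3a).** If for every half-set `Y` (size `c`, `|Y∩H| ≤ x`) the line section of the
stripped ground set (type `(a_Y,b_Y,d_Y)`, sample `s`, offset `x' = x − |Y∩H|`) admits mode brackets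
`lo + 1 ≤ hi` (`D(lo) < N(lo)`, `N(hi) < D(hi)`) with the margins of `TrinomialLineSection.var_lineW_ge_of_bracket`
(`hi + L + M ≤ a_Y`, `M + L ≤ lo + 3`, `L ≤ lo`, `2(hi+L) + M + 1 ≤ x'`, `x' + M + 2L ≤ 2(lo+1) + b_Y + 3`,
`x' + M + L ≤ s + lo + 3`, `s + hi + L + M ≤ x' + d_Y`), and `2 ≤ M`, `1 ≤ L`, `16L(L+1) ≤ M`, `4r + 2 ≤ L + 1`,
then for every real centre `m`:
`(r²/2)·#{U ∈ Shell_S(c+2s,c) : |U∩H| = x} ≤ Σ_{U ∈ Shell_S(c+2s,c), |U∩H| = x} (n_A(U) − m)²`.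
[cite: Rothvoss2017, §2 (PDF p. 6)] [cite: ChattamvelliShanmugam2020, §7.4 (PDF p. 144)] -/
theorem centredSq_section_ge_of_brackets {S : Finset (Fin n)} (hS : ∀ v ∈ S, π v ∈ S)
    (H : Finset (Fin n)) (c s x M L r : ℕ) (m : ℝ) (hM : 2 ≤ M) (hL1 : 1 ≤ L)
    (hLM : 16 * (L * (L + 1)) ≤ M) (hr : 4 * r + 2 ≤ L + 1)
    (hcomp : ∀ Y ∈ halfSets π S c, (Y ∩ H).card ≤ x → ∃ lo hi : ℕ, lo + 1 ≤ hi ∧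
      (lo + 1) * (((reps π (vBH π (strip π S Y) H ∪ vBN π (strip π S Y) H)).card + 2 -
            ((x - (Y ∩ H).card) - 2 * lo)) *
          ((reps π (vBH π (strip π S Y) H ∪ vBN π (strip π S Y) H)).card + 1 - ((x - (Y ∩ H).card) - 2 * lo))) *
          (s + lo + 1 - (x - (Y ∩ H).card)) <
        ((reps π (vAA π (strip π S Y) H)).card - lo) *
          (((x - (Y ∩ H).card) - 2 * lo) * ((x - (Y ∩ H).card) - 2 * lo - 1)) *
          ((reps π (vDD π (strip π S Y) H)).card - (s + lo - (x - (Y ∩ H).card))) ∧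
      ((reps π (vAA π (strip π S Y) H)).card - hi) *
          (((x - (Y ∩ H).card) - 2 * hi) * ((x - (Y ∩ H).card) - 2 * hi - 1)) *
          ((reps π (vDD π (strip π S Y) H)).card - (s + hi - (x - (Y ∩ H).card))) <
        (hi + 1) * (((reps π (vBH π (strip π S Y) H ∪ vBN π (strip π S Y) H)).card + 2 -
            ((x - (Y ∩ H).card) - 2 * hi)) *
          ((reps π (vBH π (strip π S Y) H ∪ vBN π (strip π S Y) H)).card + 1 - ((x - (Y ∩ H).card) - 2 * hi))) *
          (s + hi + 1 - (x - (Y ∩ H).card)) ∧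
      hi + L + M ≤ (reps π (vAA π (strip π S Y) H)).card ∧ M + L ≤ lo + 3 ∧ L ≤ lo ∧
      2 * (hi + L) + M + 1 ≤ x - (Y ∩ H).card ∧
      x - (Y ∩ H).card + M + 2 * L ≤ 2 * (lo + 1) + (reps π (vBH π (strip π S Y) H ∪ vBN π (strip π S Y) H)).card + 3 ∧
      x - (Y ∩ H).card + M + L ≤ s + lo + 3 ∧
      s + hi + L + M ≤ x - (Y ∩ H).card + (reps π (vDD π (strip π S Y) H)).card) :
    ((r : ℝ) ^ 2 / 2) * (((shellIn π S (c + 2 * s) c).filter fun U => (U ∩ H).card = x).card : ℝ) ≤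
      ∑ U ∈ (shellIn π S (c + 2 * s) c).filter (fun U => (U ∩ H).card = x),
        ((((reps π (vAA π S H)).filter fun v => v ∈ U ∧ π v ∈ U).card : ℝ) - m) ^ 2 := by
  refine centredSq_section_ge_of_lineW_floor hπ hπ' hS H c s x _ m fun Y hY hx => ?_
  obtain ⟨lo, hi, hlohi, hlo, hhi, m1, m2, m2', m3, m4, m5, m6⟩ := hcomp Y hY hx
  set aY := (reps π (vAA π (strip π S Y) H)).card
  set bY := (reps π (vBH π (strip π S Y) H ∪ vBN π (strip π S Y) H)).card
  set dY := (reps π (vDD π (strip π S Y) H)).card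
  set x' := x - (Y ∩ H).card
  have t := var_lineW_ge_of_bracket aY bY dY s x' lo hi M L hM hL1 hlohi hlo hhi m1 m2 m2' m3 m4 m5 m6 hLM r hr m
  -- convert the `range (aY+1)` sums of `TrinomialLineSection` to the `range (s+1)` sums used here
  rw [← sum_range_mul_lineW_eq_of_s (fun _ w => ((w : ℕ) : ℝ)) (fun _ => by simp) aY bY dY s x',
    ← sum_range_mul_lineW_eq_of_s (fun α w => ((α : ℝ) - m) ^ 2 * ((w : ℕ) : ℝ)) (fun _ => by simp)
      aY bY dY s x'] at t
  exact t

/-! ### §5 (v5) The variance floor (V) in shell currency from LINEAR brackets -/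

/-- **(V) assembled from LINEAR brackets.** As `centredSq_section_ge_of_brackets`, with the cubic bracket
conditions of each component replaced by the three + three linear inequalities of
`TrinomialLineSection.var_lineW_ge_of_linearBracket` (`N_Y = a_Y + b_Y + d_Y`, `x' = x − |Y∩H|`):
`(lo+1)N_Y ≤ (a_Y+1)s`, `(b_Y+1)s + N_Y ≤ (x'−2lo)N_Y`, `(s+lo+1−x')N_Y < (d_Y+1)s`, `(a_Y+1)s < (hi+1)N_Y`,
`(x'−2hi)N_Y ≤ (b_Y+1)s`, `(d_Y+1)s ≤ (s+hi+1−x')N_Y`, `1 ≤ s`, `s + 1 ≤ N_Y`, plus the margins on `[lo+1, hi]`.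
Then for every real `m`: `(r²/2)·#{U ∈ Shell_S(c+2s,c) : |U∩H| = x} ≤ Σ_{U : |U∩H| = x} (n_A(U) − m)²`.
[cite: Rothvoss2017, §2 (PDF p. 6)] [cite: ChattamvelliShanmugam2020, §7.4 (PDF p. 144)] -/
theorem centredSq_section_ge_of_linearBrackets {S : Finset (Fin n)} (hS : ∀ v ∈ S, π v ∈ S)
    (H : Finset (Fin n)) (c s x M L r : ℕ) (m : ℝ) (hM : 2 ≤ M) (hL1 : 1 ≤ L)
    (hLM : 16 * (L * (L + 1)) ≤ M) (hr : 4 * r + 2 ≤ L + 1) (hs : 1 ≤ s)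
    (hcomp : ∀ Y ∈ halfSets π S c, (Y ∩ H).card ≤ x → ∃ lo hi : ℕ, lo + 1 ≤ hi ∧
      s + 1 ≤ (reps π (vAA π (strip π S Y) H)).card +
          (reps π (vBH π (strip π S Y) H ∪ vBN π (strip π S Y) H)).card + (reps π (vDD π (strip π S Y) H)).card ∧
      (lo + 1) * ((reps π (vAA π (strip π S Y) H)).card +
          (reps π (vBH π (strip π S Y) H ∪ vBN π (strip π S Y) H)).card + (reps π (vDD π (strip π S Y) H)).card) ≤
        ((reps π (vAA π (strip π S Y) H)).card + 1) * s ∧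
      ((reps π (vBH π (strip π S Y) H ∪ vBN π (strip π S Y) H)).card + 1) * s +
          ((reps π (vAA π (strip π S Y) H)).card +
            (reps π (vBH π (strip π S Y) H ∪ vBN π (strip π S Y) H)).card + (reps π (vDD π (strip π S Y) H)).card) ≤
        (x - (Y ∩ H).card - 2 * lo) * ((reps π (vAA π (strip π S Y) H)).card +
          (reps π (vBH π (strip π S Y) H ∪ vBN π (strip π S Y) H)).card + (reps π (vDD π (strip π S Y) H)).card) ∧
      (s + lo + 1 - (x - (Y ∩ H).card)) * ((reps π (vAA π (strip π S Y) H)).card +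
          (reps π (vBH π (strip π S Y) H ∪ vBN π (strip π S Y) H)).card + (reps π (vDD π (strip π S Y) H)).card) <
        ((reps π (vDD π (strip π S Y) H)).card + 1) * s ∧
      ((reps π (vAA π (strip π S Y) H)).card + 1) * s <
        (hi + 1) * ((reps π (vAA π (strip π S Y) H)).card +
          (reps π (vBH π (strip π S Y) H ∪ vBN π (strip π S Y) H)).card + (reps π (vDD π (strip π S Y) H)).card) ∧
      (x - (Y ∩ H).card - 2 * hi) * ((reps π (vAA π (strip π S Y) H)).card +
          (reps π (vBH π (strip π S Y) H ∪ vBN π (strip π S Y) H)).card + (reps π (vDD π (strip π S Y) H)).card) ≤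
        ((reps π (vBH π (strip π S Y) H ∪ vBN π (strip π S Y) H)).card + 1) * s ∧
      ((reps π (vDD π (strip π S Y) H)).card + 1) * s ≤
        (s + hi + 1 - (x - (Y ∩ H).card)) * ((reps π (vAA π (strip π S Y) H)).card +
          (reps π (vBH π (strip π S Y) H ∪ vBN π (strip π S Y) H)).card + (reps π (vDD π (strip π S Y) H)).card) ∧
      hi + L + M ≤ (reps π (vAA π (strip π S Y) H)).card ∧ M + L ≤ lo + 3 ∧ L ≤ lo ∧
      2 * (hi + L) + M + 1 ≤ x - (Y ∩ H).card ∧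
      x - (Y ∩ H).card + M + 2 * L ≤ 2 * (lo + 1) + (reps π (vBH π (strip π S Y) H ∪ vBN π (strip π S Y) H)).card + 3 ∧
      x - (Y ∩ H).card + M + L ≤ s + lo + 3 ∧
      s + hi + L + M ≤ x - (Y ∩ H).card + (reps π (vDD π (strip π S Y) H)).card) :
    ((r : ℝ) ^ 2 / 2) * (((shellIn π S (c + 2 * s) c).filter fun U => (U ∩ H).card = x).card : ℝ) ≤
      ∑ U ∈ (shellIn π S (c + 2 * s) c).filter (fun U => (U ∩ H).card = x),
        ((((reps π (vAA π S H)).filter fun v => v ∈ U ∧ π v ∈ U).card : ℝ) - m) ^ 2 := by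
  refine centredSq_section_ge_of_lineW_floor hπ hπ' hS H c s x _ m fun Y hY hx => ?_
  obtain ⟨lo, hi, hlohi, hN, i1, i2, i3, j1, j2, j3, m1, m2, m2', m3, m4, m5, m6⟩ := hcomp Y hY hx
  set aY := (reps π (vAA π (strip π S Y) H)).card
  set bY := (reps π (vBH π (strip π S Y) H ∪ vBN π (strip π S Y) H)).card
  set dY := (reps π (vDD π (strip π S Y) H)).card
  set x' := x - (Y ∩ H).card
  have t := var_lineW_ge_of_linearBracket aY bY dY s x' lo hi M L hM hL1 hlohi hs hN i1 i2 i3 j1 j2 j3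
    m1 m2 m2' m3 m4 m5 m6 hLM r hr m
  rw [← sum_range_mul_lineW_eq_of_s (fun _ w => ((w : ℕ) : ℝ)) (fun _ => by simp) aY bY dY s x',
    ← sum_range_mul_lineW_eq_of_s (fun α w => ((α : ℝ) - m) ^ 2 * ((w : ℕ) : ℝ)) (fun _ => by simp)
      aY bY dY s x'] at t
  exact t

/-! ### §6 (v6) The variance floor (V) in shell currency FROM THE WINDOW -/

/-- **(V) from the window (B3b + B3a, final form).** If every component `Y` (half-set of size `c`, `|Y∩H| ≤ x`;
type `(a_Y, b_Y, d_Y)` of `strip π S Y`, `N_Y = a_Y + b_Y + d_Y`, offset `x' = x − |Y∩H|`) has `s + 1 ≤ N_Y`, its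
offset in the real window `|x' − s(2a_Y + b_Y)/N_Y| ≤ ε`, and the six product margins `C·N_Y ≤ s·a_Y`,
`a_Y·(N_Y−s)`, `s·b_Y`, `b_Y·(N_Y−s)`, `s·d_Y`, `d_Y·(N_Y−s)` with `C = M + 2L + 3ε + 7` (`2 ≤ M`, `1 ≤ L`,
`16L(L+1) ≤ M`, `4r+2 ≤ L+1`, `1 ≤ s`), then for every real centre `m`:
`(r²/2)·#{U ∈ Shell_S(c+2s,c) : |U∩H| = x} ≤ Σ_{U ∈ Shell_S(c+2s,c), |U∩H| = x} (n_A(U) − m)²`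
(`TrinomialLineSectionBrackets.var_lineW_ge_of_window` per component + `centredSq_section_ge_of_lineW_floor`).
[cite: Rothvoss2017, §2 (PDF p. 6)] [cite: ChattamvelliShanmugam2020, §7.4 (PDF p. 144)] -/
theorem centredSq_section_ge_of_window {S : Finset (Fin n)} (hS : ∀ v ∈ S, π v ∈ S)
    (H : Finset (Fin n)) (c s x ε M L r : ℕ) (m : ℝ) (hs : 1 ≤ s) (hM : 2 ≤ M) (hL1 : 1 ≤ L)
    (hLM : 16 * (L * (L + 1)) ≤ M) (hr : 4 * r + 2 ≤ L + 1)
    (hcomp : ∀ Y ∈ halfSets π S c, (Y ∩ H).card ≤ x →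
      s + 1 ≤ ((reps π (vAA π (strip π S Y) H)).card + (reps π (vBH π (strip π S Y) H ∪ vBN π (strip π S Y) H)).card + (reps π (vDD π (strip π S Y) H)).card) ∧
      |((x - (Y ∩ H).card : ℕ) : ℝ) - (s : ℝ) * (2 * (reps π (vAA π (strip π S Y) H)).card + (reps π (vBH π (strip π S Y) H ∪ vBN π (strip π S Y) H)).card) /
          (((reps π (vAA π (strip π S Y) H)).card : ℝ) + (reps π (vBH π (strip π S Y) H ∪ vBN π (strip π S Y) H)).card + (reps π (vDD π (strip π S Y) H)).card)| ≤ ε ∧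
      (M + 2 * L + 3 * ε + 7) * ((reps π (vAA π (strip π S Y) H)).card + (reps π (vBH π (strip π S Y) H ∪ vBN π (strip π S Y) H)).card + (reps π (vDD π (strip π S Y) H)).card) ≤ s * (reps π (vAA π (strip π S Y) H)).card ∧
      (M + 2 * L + 3 * ε + 7) * ((reps π (vAA π (strip π S Y) H)).card + (reps π (vBH π (strip π S Y) H ∪ vBN π (strip π S Y) H)).card + (reps π (vDD π (strip π S Y) H)).card) ≤ (reps π (vAA π (strip π S Y) H)).card * (((reps π (vAA π (strip π S Y) H)).card + (reps π (vBH π (strip π S Y) H ∪ vBN π (strip π S Y) H)).card + (reps π (vDD π (strip π S Y) H)).card) - s) ∧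
      (M + 2 * L + 3 * ε + 7) * ((reps π (vAA π (strip π S Y) H)).card + (reps π (vBH π (strip π S Y) H ∪ vBN π (strip π S Y) H)).card + (reps π (vDD π (strip π S Y) H)).card) ≤ s * (reps π (vBH π (strip π S Y) H ∪ vBN π (strip π S Y) H)).card ∧
      (M + 2 * L + 3 * ε + 7) * ((reps π (vAA π (strip π S Y) H)).card + (reps π (vBH π (strip π S Y) H ∪ vBN π (strip π S Y) H)).card + (reps π (vDD π (strip π S Y) H)).card) ≤ (reps π (vBH π (strip π S Y) H ∪ vBN π (strip π S Y) H)).card * (((reps π (vAA π (strip π S Y) H)).card + (reps π (vBH π (strip π S Y) H ∪ vBN π (strip π S Y) H)).card + (reps π (vDD π (strip π S Y) H)).card) - s) ∧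
      (M + 2 * L + 3 * ε + 7) * ((reps π (vAA π (strip π S Y) H)).card + (reps π (vBH π (strip π S Y) H ∪ vBN π (strip π S Y) H)).card + (reps π (vDD π (strip π S Y) H)).card) ≤ s * (reps π (vDD π (strip π S Y) H)).card ∧
      (M + 2 * L + 3 * ε + 7) * ((reps π (vAA π (strip π S Y) H)).card + (reps π (vBH π (strip π S Y) H ∪ vBN π (strip π S Y) H)).card + (reps π (vDD π (strip π S Y) H)).card) ≤ (reps π (vDD π (strip π S Y) H)).card * (((reps π (vAA π (strip π S Y) H)).card + (reps π (vBH π (strip π S Y) H ∪ vBN π (strip π S Y) H)).card + (reps π (vDD π (strip π S Y) H)).card) - s)) :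
    ((r : ℝ) ^ 2 / 2) * (((shellIn π S (c + 2 * s) c).filter fun U => (U ∩ H).card = x).card : ℝ) ≤
      ∑ U ∈ (shellIn π S (c + 2 * s) c).filter (fun U => (U ∩ H).card = x),
        ((((reps π (vAA π S H)).filter fun v => v ∈ U ∧ π v ∈ U).card : ℝ) - m) ^ 2 := by
  refine centredSq_section_ge_of_lineW_floor hπ hπ' hS H c s x _ m fun Y hY hx => ?_
  obtain ⟨hN, hwin, wa, wa', wb, wb', wd, wd'⟩ := hcomp Y hY hx
  set aY := (reps π (vAA π (strip π S Y) H)).card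
  set bY := (reps π (vBH π (strip π S Y) H ∪ vBN π (strip π S Y) H)).card
  set dY := (reps π (vDD π (strip π S Y) H)).card
  set x' := x - (Y ∩ H).card
  have t := var_lineW_ge_of_window aY bY dY s x' ε M L r m hs hN hwin wa wa' wb wb' wd wd' hM hL1 hLM hr
  rw [← sum_range_mul_lineW_eq_of_s (fun _ w => ((w : ℕ) : ℝ)) (fun _ => by simp) aY bY dY s x',
    ← sum_range_mul_lineW_eq_of_s (fun α w => ((α : ℝ) - m) ^ 2 * ((w : ℕ) : ℝ)) (fun _ => by simp)
      aY bY dY s x'] at t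
  exact t

/-! ### §7 (v6) Level `1`: the floor from the GLOBAL window and the GLOBAL type margins -/

omit hπ hπ' in
/-- Window transfer to a level-`1` component (pure real arithmetic): with `P = 2a + b`, `P − 2 ≤ P' ≤ P ≤ 2N`,
`0 ≤ h ≤ 1`, `1 ≤ s`, `s + 1 ≤ N − 1`: `|x − h − s·P'/(N−1)| ≤ |x − (2s+1)P/(2N)| + 4`. [folklore] -/
private theorem window_transfer_one {x h s P P' N ε : ℝ} (hN : s + 2 ≤ N) (hs : 1 ≤ s) (hP0 : 0 ≤ P')
    (hPP : P' ≤ P) (hP2 : P ≤ P' + 2) (hPN : P ≤ 2 * N) (hh0 : 0 ≤ h) (hh1 : h ≤ 1)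
    (hx : |x - (2 * s + 1) * P / (2 * N)| ≤ ε) :
    |x - h - s * P' / (N - 1)| ≤ ε + 4 := by
  have hN1 : 0 < N - 1 := by linarith
  have hN0 : 0 < N := by linarith
  -- `|(2s+1)P/(2N) − sP/(N−1)| ≤ 1`
  have e1 : (2 * s + 1) * P / (2 * N) - s * P / (N - 1) = P * (N - 1 - 2 * s) / (2 * N * (N - 1)) := by
    field_simp
    ring
  have b1 : |(2 * s + 1) * P / (2 * N) - s * P / (N - 1)| ≤ 1 := by
    rw [e1, abs_div, abs_of_pos (by positivity : (0 : ℝ) < 2 * N * (N - 1)), div_le_one (by positivity),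
      abs_mul, abs_of_nonneg (hP0.trans hPP)]
    have : |N - 1 - 2 * s| ≤ N - 1 := by rw [abs_le]; constructor <;> linarith
    calc P * |N - 1 - 2 * s| ≤ 2 * N * (N - 1) := by
          apply mul_le_mul hPN this (abs_nonneg _) (by linarith)
      _ = 2 * N * (N - 1) := rfl
  -- `|sP/(N−1) − sP'/(N−1)| ≤ 2`
  have b2 : |s * P / (N - 1) - s * P' / (N - 1)| ≤ 2 := by
    rw [← sub_div, ← mul_sub, abs_div, abs_of_pos hN1, div_le_iff₀ hN1, abs_mul, abs_of_nonneg (by linarith : (0:ℝ) ≤ s),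
      abs_of_nonneg (by linarith : (0:ℝ) ≤ P - P')]
    nlinarith
  have b3 : |h| ≤ 1 := by rw [abs_le]; constructor <;> linarith
  calc |x - h - s * P' / (N - 1)|
      = |(x - (2 * s + 1) * P / (2 * N)) + ((2 * s + 1) * P / (2 * N) - s * P / (N - 1)) +
          (s * P / (N - 1) - s * P' / (N - 1)) - h| := by ring_nf
    _ ≤ |x - (2 * s + 1) * P / (2 * N)| + |(2 * s + 1) * P / (2 * N) - s * P / (N - 1)| +
          |s * P / (N - 1) - s * P' / (N - 1)| + |h| := by
        refine (abs_sub _ _).trans ?_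
        refine add_le_add ((abs_add_le _ _).trans (add_le_add ((abs_add_le _ _).trans le_rfl) le_rfl)) le_rfl
    _ ≤ ε + 1 + 2 + 1 := by linarith
    _ = ε + 4 := by ring

set_option maxHeartbeats 400000 in
/-- **(V) at level `1` from the GLOBAL window and the GLOBAL type margins.** For a `π`-stable `S` of `H`-type
`(a, b, d)` (`N = a + b + d` edges), `s` full edges (cut `1 + 2s`), `1 ≤ s`, `s + 2 ≤ N`, the block value `x` in
the window `|x − (2s+1)(2a+b)/(2N)| ≤ ε₀` (the cell's window for cut `2s+1` on `2N` vertices) and the six product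
margins `C·(N−1) ≤ s·(a−1)`, `C·(N−1) ≤ (a−1)·(N−1−s)`, `C·(N−1) ≤ s·(b−1)`, `C·(N−1) ≤ (b−1)·(N−1−s)`,
`C·(N−1) ≤ s·(d−1)`, `C·(N−1) ≤ (d−1)·(N−1−s)` with `C = M + 2L + 3(ε₀+4) + 7` (`2 ≤ M`, `1 ≤ L`, `16L(L+1) ≤ M`,
`4r + 2 ≤ L + 1`): for every real centre `m`,
`(r²/2)·#{U ∈ Shell_S(1+2s,1) : |U∩H| = x} ≤ Σ_{U ∈ Shell_S(1+2s,1), |U∩H| = x} (n_A(U) − m)²`.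
(Each component `Y = {v}` has type `(a_Y,b_Y,d_Y)` with `a−1 ≤ a_Y ≤ a` etc., `N_Y = N − 1`
(`ShellLawBulkSmoothness.strip_one_types`), offset `x − |Y∩H|`, `|Y∩H| ≤ 1`; its window is the global one `+ 4`.)
[cite: Rothvoss2017, §2 (PDF p. 6)] [cite: ChattamvelliShanmugam2020, §7.4 (PDF p. 144)] -/
theorem centredSq_section_ge_of_window_one {S : Finset (Fin n)} (hS : ∀ v ∈ S, π v ∈ S) (H : Finset (Fin n))
    {a b d : ℕ} (ha : (reps π (vAA π S H)).card = a) (hb : (reps π (vBH π S H ∪ vBN π S H)).card = b)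
    (hd : (reps π (vDD π S H)).card = d) (s x ε₀ M L r : ℕ) (m : ℝ) (hs : 1 ≤ s) (hsN : s + 2 ≤ a + b + d)
    (hx : |(x : ℝ) - (2 * s + 1) * (2 * a + b) / (2 * ((a : ℝ) + b + d))| ≤ ε₀)
    (wa : (M + 2 * L + 3 * (ε₀ + 4) + 7) * (a + b + d - 1) ≤ s * (a - 1))
    (wa' : (M + 2 * L + 3 * (ε₀ + 4) + 7) * (a + b + d - 1) ≤ (a - 1) * (a + b + d - 1 - s))
    (wb : (M + 2 * L + 3 * (ε₀ + 4) + 7) * (a + b + d - 1) ≤ s * (b - 1))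
    (wb' : (M + 2 * L + 3 * (ε₀ + 4) + 7) * (a + b + d - 1) ≤ (b - 1) * (a + b + d - 1 - s))
    (wd : (M + 2 * L + 3 * (ε₀ + 4) + 7) * (a + b + d - 1) ≤ s * (d - 1))
    (wd' : (M + 2 * L + 3 * (ε₀ + 4) + 7) * (a + b + d - 1) ≤ (d - 1) * (a + b + d - 1 - s))
    (hM : 2 ≤ M) (hL1 : 1 ≤ L) (hLM : 16 * (L * (L + 1)) ≤ M) (hr : 4 * r + 2 ≤ L + 1) :
    ((r : ℝ) ^ 2 / 2) * (((shellIn π S (1 + 2 * s) 1).filter fun U => (U ∩ H).card = x).card : ℝ) ≤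
      ∑ U ∈ (shellIn π S (1 + 2 * s) 1).filter (fun U => (U ∩ H).card = x),
        ((((reps π (vAA π S H)).filter fun v => v ∈ U ∧ π v ∈ U).card : ℝ) - m) ^ 2 := by
  refine centredSq_section_ge_of_window hπ hπ' hS H 1 s x (ε₀ + 4) M L r m hs hM hL1 hLM hr fun Y hY hxY => ?_
  obtain ⟨t1, t2, t3, t4, t5, t6, t7⟩ := strip_one_types hπ hπ' hS H hY
  obtain ⟨v, hv, hYv, hYH⟩ := halfSets_one_data (π := π) (H := H) hπ' hY
  rw [ha] at t1 t2 t7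
  rw [hb] at t3 t4 t7
  rw [hd] at t5 t6 t7
  set aY := (reps π (vAA π (strip π S Y) H)).card with haY
  set bY := (reps π (vBH π (strip π S Y) H ∪ vBN π (strip π S Y) H)).card with hbY
  set dY := (reps π (vDD π (strip π S Y) H)).card with hdY
  have hNY : aY + bY + dY = a + b + d - 1 := by omega
  have e3 : 3 * (ε₀ + 4) = 3 * ε₀ + 12 := by ring
  refine ⟨by omega, ?_, ?_, ?_, ?_, ?_, ?_, ?_⟩
  · -- the component window from the global one
    have hxr : ((x - (Y ∩ H).card : ℕ) : ℝ) = (x : ℝ) - ((Y ∩ H).card : ℝ) := by push_cast [Nat.cast_sub hxY]; ring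
    rw [hxr]
    have hNr : ((aY : ℝ) + bY + dY) = ((a : ℝ) + b + d) - 1 := by
      have : ((aY + bY + dY : ℕ) : ℝ) = ((a + b + d - 1 : ℕ) : ℝ) := by rw [hNY]
      push_cast [Nat.cast_sub (show 1 ≤ a + b + d by omega)] at this; linarith
    rw [hNr]
    have t := window_transfer_one (x := (x : ℝ)) (h := ((Y ∩ H).card : ℝ)) (s := (s : ℝ)) (P := 2 * (a : ℝ) + b)
      (P' := 2 * (aY : ℝ) + bY) (N := (a : ℝ) + b + d) (ε := (ε₀ : ℝ))
      (by exact_mod_cast (show s + 2 ≤ a + b + d from hsN)) (by exact_mod_cast hs) (by positivity)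
      (by have : (aY : ℝ) ≤ a := by exact_mod_cast t2
          have : (bY : ℝ) ≤ b := by exact_mod_cast t4
          linarith)
      (by have hP : 2 * a + b ≤ 2 * aY + bY + 2 := by omega
          exact_mod_cast hP)
      (by have : (0 : ℝ) ≤ d := by positivity
          linarith)
      (by positivity) (by exact_mod_cast hYH)
      (by simpa [mul_comm, mul_assoc, mul_left_comm] using hx)
    have e : ((ε₀ : ℝ) + 4) = ((ε₀ + 4 : ℕ) : ℝ) := by push_cast; ring
    rw [← e]
    simpa [mul_comm, mul_assoc, mul_left_comm] using t
  · calc (M + 2 * L + 3 * (ε₀ + 4) + 7) * (aY + bY + dY) = (M + 2 * L + 3 * (ε₀ + 4) + 7) * (a + b + d - 1) := by rw [hNY]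
      _ ≤ s * (a - 1) := wa
      _ ≤ s * aY := Nat.mul_le_mul_left _ (by omega)
  · calc (M + 2 * L + 3 * (ε₀ + 4) + 7) * (aY + bY + dY) = (M + 2 * L + 3 * (ε₀ + 4) + 7) * (a + b + d - 1) := by rw [hNY]
      _ ≤ (a - 1) * (a + b + d - 1 - s) := wa'
      _ ≤ aY * (aY + bY + dY - s) := by rw [hNY]; exact Nat.mul_le_mul_right _ (by omega)
  · calc (M + 2 * L + 3 * (ε₀ + 4) + 7) * (aY + bY + dY) = (M + 2 * L + 3 * (ε₀ + 4) + 7) * (a + b + d - 1) := by rw [hNY]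
      _ ≤ s * (b - 1) := wb
      _ ≤ s * bY := Nat.mul_le_mul_left _ (by omega)
  · calc (M + 2 * L + 3 * (ε₀ + 4) + 7) * (aY + bY + dY) = (M + 2 * L + 3 * (ε₀ + 4) + 7) * (a + b + d - 1) := by rw [hNY]
      _ ≤ (b - 1) * (a + b + d - 1 - s) := wb'
      _ ≤ bY * (aY + bY + dY - s) := by rw [hNY]; exact Nat.mul_le_mul_right _ (by omega)
  · calc (M + 2 * L + 3 * (ε₀ + 4) + 7) * (aY + bY + dY) = (M + 2 * L + 3 * (ε₀ + 4) + 7) * (a + b + d - 1) := by rw [hNY]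
      _ ≤ s * (d - 1) := wd
      _ ≤ s * dY := Nat.mul_le_mul_left _ (by omega)
  · calc (M + 2 * L + 3 * (ε₀ + 4) + 7) * (aY + bY + dY) = (M + 2 * L + 3 * (ε₀ + 4) + 7) * (a + b + d - 1) := by rw [hNY]
      _ ≤ (d - 1) * (a + b + d - 1 - s) := wd'
      _ ≤ dY * (aY + bY + dY - s) := by rw [hNY]; exact Nat.mul_le_mul_right _ (by omega)

/-! ### §8 (v7) Level `1` on the ground set of the matching, in LAW currency: the hypothesis `hV` of the
Summits-side assembly -/

omit hπ hπ' in
/-- Inside the full ground set the relative shells are the shells (`ShellLawSmoothing.shellIn_univ`, restated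
locally to keep this file's imports minimal). [cite: Rothvoss2017, §2 (PDF p. 6)] -/
private theorem shellIn_univ_eq (π : Fin n → Fin n) (t c : ℕ) : shellIn π univ t c = shell π t c := by
  ext U; simp [shellIn, shell]

/-- **The variance floor (V) at level `1` in LAW currency, on the ground set `univ` of the matching** — the
form the cell's Summits-side assembly consumes as the hypothesis
`hV : c_V · law_{[n]}(2s+1,1;x) ≤ A^m_1(x) = (Σ_{U ∈ Shell(2s+1,1), |U∩H| = x} (n_A(U) − m)²)/|Shell(2s+1,1)|`
(bricks 137/137b `sum_abs_fwdDiff_centredFirst_le…`, brick 138's READING, brick 139), with `c_V = r²/2`: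
for a fixed-point-free involution `π` on `Fin n`, a block `H` of GLOBAL type `(a, b, d)` (numbers of `HH`,
mixed, `NN` edges of the matching), a cut `2s+1` with `1 ≤ s`, `s + 2 ≤ a + b + d`, a point `x` in the cell's
window `|x − (2s+1)(2a+b)/(2(a+b+d))| ≤ ε₀`, the six global product margins
`C·(a+b+d−1) ≤ s(a−1), (a−1)(a+b+d−1−s), s(b−1), (b−1)(a+b+d−1−s), s(d−1), (d−1)(a+b+d−1−s)` with
`C = M + 2L + 3(ε₀+4) + 7`, and `2 ≤ M`, `1 ≤ L`, `16L(L+1) ≤ M`, `4r+2 ≤ L+1`: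
`(r²/2) · law_{univ}(2s+1,1;x) ≤ (Σ_{U ∈ Shell(2s+1,1), |U∩H| = x} (n_A(U) − m)²) / |Shell(2s+1,1)|`
for EVERY real `m` — `centredSq_section_ge_of_window_one` for `S = univ` divided by the shell size (both sides
are `0` for an empty shell). The block statistic is compared in `ℤ` (`(|U∩H| : ℤ) = x`) and the cut is written
`2s+1`, as in the consumers. Constants crude; the margins are met in the cell's regime only asymptotically
(`s ≍ βN`, `r ≍ N^{1/4}`, window width `≍ √N·polylog ≪ s`), which is the assembly's numerics, not this file's.
[cite: Rothvoss2017, §2 (PDF p. 6)] [cite: ChattamvelliShanmugam2020, §7.4 (PDF p. 144)] -/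
theorem centredSq_law_ge_of_window_one (H : Finset (Fin n)) {a b d : ℕ}
    (ha : (reps π (vAA π univ H)).card = a) (hb : (reps π (vBH π univ H ∪ vBN π univ H)).card = b)
    (hd : (reps π (vDD π univ H)).card = d) (s x ε₀ M L r : ℕ) (m : ℝ) (hs : 1 ≤ s) (hsN : s + 2 ≤ a + b + d)
    (hx : |(x : ℝ) - (2 * s + 1) * (2 * a + b) / (2 * ((a : ℝ) + b + d))| ≤ ε₀)
    (wa : (M + 2 * L + 3 * (ε₀ + 4) + 7) * (a + b + d - 1) ≤ s * (a - 1))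
    (wa' : (M + 2 * L + 3 * (ε₀ + 4) + 7) * (a + b + d - 1) ≤ (a - 1) * (a + b + d - 1 - s))
    (wb : (M + 2 * L + 3 * (ε₀ + 4) + 7) * (a + b + d - 1) ≤ s * (b - 1))
    (wb' : (M + 2 * L + 3 * (ε₀ + 4) + 7) * (a + b + d - 1) ≤ (b - 1) * (a + b + d - 1 - s))
    (wd : (M + 2 * L + 3 * (ε₀ + 4) + 7) * (a + b + d - 1) ≤ s * (d - 1))
    (wd' : (M + 2 * L + 3 * (ε₀ + 4) + 7) * (a + b + d - 1) ≤ (d - 1) * (a + b + d - 1 - s))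
    (hM : 2 ≤ M) (hL1 : 1 ≤ L) (hLM : 16 * (L * (L + 1)) ≤ M) (hr : 4 * r + 2 ≤ L + 1) :
    ((r : ℝ) ^ 2 / 2) * shellLaw π univ H (2 * s + 1) 1 (x : ℤ) ≤
      (∑ U ∈ (shell π (2 * s + 1) 1).filter (fun U => ((U ∩ H).card : ℤ) = (x : ℤ)),
          (((((reps π (vAA π univ H)).filter fun v => v ∈ U ∧ π v ∈ U).card : ℕ) : ℝ) - m) ^ 2) /
        ((shell π (2 * s + 1) 1).card : ℝ) := by
  have hS : ∀ v ∈ (univ : Finset (Fin n)), π v ∈ (univ : Finset (Fin n)) := fun v _ => mem_univ _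
  have key := centredSq_section_ge_of_window_one hπ hπ' hS H ha hb hd s x ε₀ M L r m hs hsN hx wa wa' wb wb' wd
    wd' hM hL1 hLM hr
  have e1 : shellIn π univ (1 + 2 * s) 1 = shell π (2 * s + 1) 1 := by rw [add_comm, shellIn_univ_eq]
  have e2 : ((shell π (2 * s + 1) 1).filter fun U => ((U ∩ H).card : ℤ) = (x : ℤ)) =
      (shell π (2 * s + 1) 1).filter fun U => (U ∩ H).card = x :=
    filter_congr fun U _ => by exact_mod_cast Iff.rfl
  rw [e1] at key
  rw [shellLaw, shellCount, shellIn_univ_eq, e2, ← mul_div_assoc]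
  exact div_le_div_of_nonneg_right key (Nat.cast_nonneg _)

/-! ### §9 (v8) TURNKEY: (V) at level `1` from a REAL radius, a REAL window and the type margins only

The integer parameters of §8 are chosen canonically (`r = ⌈ρ⌉`, `L = 4r+1`, `M = 16L(L+1)`, `ε₀ = ⌈ε⌉`, so that
`16L(L+1) ≤ M` and `4r+2 ≤ L+1` hold with equality and `C = M + 2L + 3(ε₀+4) + 7 ≤ 256(ρ+2)² + 3ε + 3`), and the
six product margins are replaced by the sufficient conditions `β(N₀−1) ≤ s ≤ (1−β)(N₀−1)` and
`256(ρ+2)² + 3ε + 3 ≤ β·(min(a,b,d) − 1)` (then `C(N₀−1) ≤ β(a−1)(N₀−1) ≤ (a−1)·s` and `≤ (a−1)(N₀−1−s)`, etc.).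
-/

omit hπ hπ' in
/-- The canonical constant: with `r = ⌈ρ⌉`, `ε₀ = ⌈ε⌉`, `L = 4r+1`, `M = 16L(L+1)`,
`M + 2L + 3(ε₀+4) + 7 = 256r² + 200r + 53 + 3ε₀ ≤ 256(ρ+2)² + 3ε + 3` (pure real arithmetic).
[cite: ChattamvelliShanmugam2020, §7.4 (PDF p. 144)] -/
private theorem turnkey_const_le {ρ ε : ℝ} (hρ : 0 ≤ ρ) (hε : 0 ≤ ε) :
    ((16 * ((4 * ⌈ρ⌉₊ + 1) * (4 * ⌈ρ⌉₊ + 1 + 1)) + 2 * (4 * ⌈ρ⌉₊ + 1) + 3 * (⌈ε⌉₊ + 4) + 7 : ℕ) : ℝ) ≤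
      256 * (ρ + 2) ^ 2 + 3 * ε + 3 := by
  have hr : (⌈ρ⌉₊ : ℝ) < ρ + 1 := Nat.ceil_lt_add_one hρ
  have he : (⌈ε⌉₊ : ℝ) < ε + 1 := Nat.ceil_lt_add_one hε
  have hr0 : (0 : ℝ) ≤ ⌈ρ⌉₊ := Nat.cast_nonneg _
  have hr2 : (⌈ρ⌉₊ : ℝ) ^ 2 ≤ (ρ + 1) ^ 2 := pow_le_pow_left₀ hr0 hr.le 2
  push_cast
  nlinarith [hr, he, hr0, hr2, hρ]

/-- **(V) TURNKEY (three type margins).** For a fixed-point-free involution `π` on `Fin n`, a block `H` of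
global type `(a, b, d)`, `a + b + d = N₀`, a real `β > 0`, a number of full edges `s` with
`β(N₀−1) ≤ s ≤ (1−β)(N₀−1)`, a point `x` in the real window `|x − (2s+1)(2a+b)/(2N₀)| ≤ ε`, and a real radius
`ρ ≥ 0` with `256(ρ+2)² + 3ε + 3 ≤ β(a−1)`, `≤ β(b−1)`, `≤ β(d−1)`: for EVERY real centre `m`,
`(ρ²/2) · law_{univ}(2s+1,1;x) ≤ (Σ_{U ∈ Shell(2s+1,1), |U∩H| = x} (n_A(U) − m)²) / |Shell(2s+1,1)|`
— §8 `centredSq_law_ge_of_window_one` with `r = ⌈ρ⌉`, `ε₀ = ⌈ε⌉`, `L = 4r+1`, `M = 16L(L+1)` (its six product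
margins follow from the three real margins and the two bounds on `s`). This is the hypothesis `hV`/`hVA` of the
cell's Summits-side bricks 137b/139 with `cV = V = ρ²/2`, free of integer side conditions.
[cite: Rothvoss2017, §2 (PDF p. 6)] [cite: ChattamvelliShanmugam2020, §7.4 (PDF p. 144)] -/
theorem centredSq_law_ge_of_typeMargins (H : Finset (Fin n)) {a b d N₀ : ℕ}
    (ha : (reps π (vAA π univ H)).card = a) (hb : (reps π (vBH π univ H ∪ vBN π univ H)).card = b)
    (hd : (reps π (vDD π univ H)).card = d) (hN : a + b + d = N₀)
    {β : ℝ} (hβ : 0 < β) {s : ℕ} (hsβ : β * ((N₀ : ℝ) - 1) ≤ s) (hsβ' : (s : ℝ) ≤ (1 - β) * ((N₀ : ℝ) - 1))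
    {x : ℕ} {ε : ℝ} (hx : |(x : ℝ) - (2 * s + 1) * (2 * a + b) / (2 * (N₀ : ℝ))| ≤ ε)
    {ρ : ℝ} (hρ : 0 ≤ ρ)
    (hCa : 256 * (ρ + 2) ^ 2 + 3 * ε + 3 ≤ β * ((a : ℝ) - 1))
    (hCb : 256 * (ρ + 2) ^ 2 + 3 * ε + 3 ≤ β * ((b : ℝ) - 1))
    (hCd : 256 * (ρ + 2) ^ 2 + 3 * ε + 3 ≤ β * ((d : ℝ) - 1)) (m : ℝ) :
    (ρ ^ 2 / 2) * shellLaw π univ H (2 * s + 1) 1 (x : ℤ) ≤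
      (∑ U ∈ (shell π (2 * s + 1) 1).filter (fun U => ((U ∩ H).card : ℤ) = (x : ℤ)),
          (((((reps π (vAA π univ H)).filter fun v => v ∈ U ∧ π v ∈ U).card : ℕ) : ℝ) - m) ^ 2) /
        ((shell π (2 * s + 1) 1).card : ℝ) := by
  -- the canonical integer parameters
  obtain ⟨r, hr⟩ : ∃ r : ℕ, ⌈ρ⌉₊ = r := ⟨_, rfl⟩
  obtain ⟨ε₀, hε₀⟩ : ∃ e : ℕ, ⌈ε⌉₊ = e := ⟨_, rfl⟩
  obtain ⟨L, hL⟩ : ∃ L : ℕ, 4 * r + 1 = L := ⟨_, rfl⟩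
  obtain ⟨M, hM⟩ : ∃ M : ℕ, 16 * (L * (L + 1)) = M := ⟨_, rfl⟩
  have hε : 0 ≤ ε := (abs_nonneg _).trans hx
  have hρr : ρ ≤ r := by rw [← hr]; exact Nat.le_ceil ρ
  have hεε₀ : ε ≤ ε₀ := by rw [← hε₀]; exact Nat.le_ceil ε
  -- the constant `C = M + 2L + 3(ε₀+4) + 7 ≤ 256(ρ+2)² + 3ε + 3`
  have hC : ((M + 2 * L + 3 * (ε₀ + 4) + 7 : ℕ) : ℝ) ≤ 256 * (ρ + 2) ^ 2 + 3 * ε + 3 := by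
    rw [← hM, ← hL, ← hr, ← hε₀]; exact turnkey_const_le hρ hε
  have hC0 : (0 : ℝ) < ((M + 2 * L + 3 * (ε₀ + 4) + 7 : ℕ) : ℝ) := by positivity
  -- `a, b, d ≥ 2`, `N₀ ≥ 6`, `1 ≤ s ≤ N₀ − 2`
  have hpos : ∀ {e : ℕ}, 256 * (ρ + 2) ^ 2 + 3 * ε + 3 ≤ β * ((e : ℝ) - 1) → 2 ≤ e := by
    intro e he
    by_contra h
    have h1 : (e : ℝ) ≤ 1 := by exact_mod_cast Nat.lt_succ_iff.1 (not_le.1 h)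
    have h2 : β * ((e : ℝ) - 1) ≤ 0 := mul_nonpos_of_nonneg_of_nonpos hβ.le (by linarith only [h1])
    linarith only [hC0, hC, he, h2]
  have ha2 : 2 ≤ a := hpos hCa
  have hb2 : 2 ≤ b := hpos hCb
  have hd2 : 2 ≤ d := hpos hCd
  have hN6 : 6 ≤ N₀ := by omega
  have hNr : ((a : ℝ) + b + d) = N₀ := by exact_mod_cast hN
  have hN1 : (0 : ℝ) < (N₀ : ℝ) - 1 := by
    have : (6 : ℝ) ≤ N₀ := by exact_mod_cast hN6
    linarith only [this]
  have hsβ'' : β * ((N₀ : ℝ) - 1) ≤ (N₀ : ℝ) - 1 - s := by linarith only [hsβ']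
  have hs1 : 1 ≤ s := by
    have h0 : (0 : ℝ) < s := lt_of_lt_of_le (mul_pos hβ hN1) hsβ
    have h0' : 0 < s := by exact_mod_cast h0
    omega
  have hsN : s + 2 ≤ N₀ := by
    have h1 : (s : ℝ) < (N₀ : ℝ) - 1 := by linarith only [hsβ'', mul_pos hβ hN1]
    have h2 : s + 1 < N₀ := by exact_mod_cast (show (s : ℝ) + 1 < N₀ by linarith only [h1])
    omega
  have ha1 : (0 : ℝ) ≤ (a : ℝ) - 1 := by
    have : (2 : ℝ) ≤ a := by exact_mod_cast ha2
    linarith only [this]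
  have hb1 : (0 : ℝ) ≤ (b : ℝ) - 1 := by
    have : (2 : ℝ) ≤ b := by exact_mod_cast hb2
    linarith only [this]
  have hd1 : (0 : ℝ) ≤ (d : ℝ) - 1 := by
    have : (2 : ℝ) ≤ d := by exact_mod_cast hd2
    linarith only [this]
  -- casts of the truncated subtractions
  have e1 : ((a + b + d - 1 : ℕ) : ℝ) = (N₀ : ℝ) - 1 := by
    rw [hN, Nat.cast_sub (by omega : 1 ≤ N₀), Nat.cast_one]
  have e2 : ((a + b + d - 1 - s : ℕ) : ℝ) = (N₀ : ℝ) - 1 - s := by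
    rw [hN, Nat.cast_sub (by omega : s ≤ N₀ - 1), Nat.cast_sub (by omega : 1 ≤ N₀), Nat.cast_one]
  have ea : ((a - 1 : ℕ) : ℝ) = (a : ℝ) - 1 := by rw [Nat.cast_sub (by omega : 1 ≤ a), Nat.cast_one]
  have eb : ((b - 1 : ℕ) : ℝ) = (b : ℝ) - 1 := by rw [Nat.cast_sub (by omega : 1 ≤ b), Nat.cast_one]
  have ed : ((d - 1 : ℕ) : ℝ) = (d : ℝ) - 1 := by rw [Nat.cast_sub (by omega : 1 ≤ d), Nat.cast_one]
  -- the six product margins, proved in `ℝ` and cast back to `ℕ`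
  have marg : ∀ {e : ℕ}, 0 ≤ (e : ℝ) - 1 → 256 * (ρ + 2) ^ 2 + 3 * ε + 3 ≤ β * ((e : ℝ) - 1) →
      ((e - 1 : ℕ) : ℝ) = (e : ℝ) - 1 →
      (M + 2 * L + 3 * (ε₀ + 4) + 7) * (a + b + d - 1) ≤ s * (e - 1) ∧
        (M + 2 * L + 3 * (ε₀ + 4) + 7) * (a + b + d - 1) ≤ (e - 1) * (a + b + d - 1 - s) := by
    intro e he1 hCe ee
    have hCe' : ((M + 2 * L + 3 * (ε₀ + 4) + 7 : ℕ) : ℝ) ≤ β * ((e : ℝ) - 1) := hC.trans hCe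
    constructor
    · have h : ((M + 2 * L + 3 * (ε₀ + 4) + 7 : ℕ) : ℝ) * ((N₀ : ℝ) - 1) ≤ (s : ℝ) * ((e : ℝ) - 1) :=
        calc ((M + 2 * L + 3 * (ε₀ + 4) + 7 : ℕ) : ℝ) * ((N₀ : ℝ) - 1)
            ≤ (β * ((e : ℝ) - 1)) * ((N₀ : ℝ) - 1) := mul_le_mul_of_nonneg_right hCe' hN1.le
          _ = ((e : ℝ) - 1) * (β * ((N₀ : ℝ) - 1)) := by ring
          _ ≤ ((e : ℝ) - 1) * s := mul_le_mul_of_nonneg_left hsβ he1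
          _ = (s : ℝ) * ((e : ℝ) - 1) := by ring
      rw [← e1, ← ee] at h
      exact_mod_cast h
    · have h : ((M + 2 * L + 3 * (ε₀ + 4) + 7 : ℕ) : ℝ) * ((N₀ : ℝ) - 1) ≤ ((e : ℝ) - 1) * ((N₀ : ℝ) - 1 - s) :=
        calc ((M + 2 * L + 3 * (ε₀ + 4) + 7 : ℕ) : ℝ) * ((N₀ : ℝ) - 1)
            ≤ (β * ((e : ℝ) - 1)) * ((N₀ : ℝ) - 1) := mul_le_mul_of_nonneg_right hCe' hN1.le
          _ = ((e : ℝ) - 1) * (β * ((N₀ : ℝ) - 1)) := by ring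
          _ ≤ ((e : ℝ) - 1) * ((N₀ : ℝ) - 1 - s) := mul_le_mul_of_nonneg_left hsβ'' he1
      rw [← e2, ← e1, ← ee] at h
      exact_mod_cast h
  obtain ⟨wa, wa'⟩ := marg ha1 hCa ea
  obtain ⟨wb, wb'⟩ := marg hb1 hCb eb
  obtain ⟨wd, wd'⟩ := marg hd1 hCd ed
  -- the window with the integer half-width `ε₀`
  have hx' : |(x : ℝ) - (2 * s + 1) * (2 * a + b) / (2 * ((a : ℝ) + b + d))| ≤ ε₀ := by
    rw [hNr]; exact hx.trans hεε₀
  -- the side conditions of §8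
  have hL1 : 1 ≤ L := by omega
  have hLL : 0 < L * (L + 1) := Nat.mul_pos (by omega) (by omega)
  have hM2 : 2 ≤ M := by rw [← hM]; omega
  have hLM : 16 * (L * (L + 1)) ≤ M := hM.le
  have hr4 : 4 * r + 2 ≤ L + 1 := by omega
  have key := centredSq_law_ge_of_window_one hπ hπ' H ha hb hd s x ε₀ M L r m hs1 (by omega) hx' wa wa' wb wb'
    wd wd' hM2 hL1 hLM hr4
  -- `ρ ≤ r`
  have hlaw0 : 0 ≤ shellLaw π univ H (2 * s + 1) 1 (x : ℤ) := by
    unfold shellLaw shellCount; exact div_nonneg (Nat.cast_nonneg _) (Nat.cast_nonneg _)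
  have hρ2 : ρ ^ 2 / 2 ≤ (r : ℝ) ^ 2 / 2 := by
    have := pow_le_pow_left₀ hρ hρr 2
    linarith only [this]
  exact (mul_le_mul_of_nonneg_right hρ2 hlaw0).trans key

/-- **(V) TURNKEY, `shellIn univ` spelling** — `centredSq_law_ge_of_typeMargins` with the sum and the shell
size written over `shellIn π univ (2s+1) 1` (the spelling of brick 139's `P₁ univ (2s+1) x` after `hP₁`).
[cite: Rothvoss2017, §2 (PDF p. 6)] [cite: ChattamvelliShanmugam2020, §7.4 (PDF p. 144)] -/
theorem centredSq_law_ge_of_typeMargins_shellIn (H : Finset (Fin n)) {a b d N₀ : ℕ}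
    (ha : (reps π (vAA π univ H)).card = a) (hb : (reps π (vBH π univ H ∪ vBN π univ H)).card = b)
    (hd : (reps π (vDD π univ H)).card = d) (hN : a + b + d = N₀)
    {β : ℝ} (hβ : 0 < β) {s : ℕ} (hsβ : β * ((N₀ : ℝ) - 1) ≤ s) (hsβ' : (s : ℝ) ≤ (1 - β) * ((N₀ : ℝ) - 1))
    {x : ℕ} {ε : ℝ} (hx : |(x : ℝ) - (2 * s + 1) * (2 * a + b) / (2 * (N₀ : ℝ))| ≤ ε)
    {ρ : ℝ} (hρ : 0 ≤ ρ)
    (hCa : 256 * (ρ + 2) ^ 2 + 3 * ε + 3 ≤ β * ((a : ℝ) - 1))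
    (hCb : 256 * (ρ + 2) ^ 2 + 3 * ε + 3 ≤ β * ((b : ℝ) - 1))
    (hCd : 256 * (ρ + 2) ^ 2 + 3 * ε + 3 ≤ β * ((d : ℝ) - 1)) (m : ℝ) :
    (ρ ^ 2 / 2) * shellLaw π univ H (2 * s + 1) 1 (x : ℤ) ≤
      (∑ U ∈ (shellIn π univ (2 * s + 1) 1).filter (fun U => ((U ∩ H).card : ℤ) = (x : ℤ)),
          (((((reps π (vAA π univ H)).filter fun v => v ∈ U ∧ π v ∈ U).card : ℕ) : ℝ) - m) ^ 2) /
        ((shellIn π univ (2 * s + 1) 1).card : ℝ) := by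
  rw [shellIn_univ_eq]
  exact centredSq_law_ge_of_typeMargins hπ hπ' H ha hb hd hN hβ hsβ hsβ' hx hρ hCa hCb hCd m

/-- **(V) TURNKEY in the cell's standard type-margin currency** (the hypothesis pack of
`ShellLawWindowLowerBoundAFree.shellLaw_one_window_lower_afree` / the Summits-side `bulk_numerics`): type margins
`βN₀ + 1 ≤ a, b, d` with `0 < β ≤ 1/4`, full edges `βN₀ ≤ s`, `8s ≤ (4+β)N₀`, the real window
`|x − (2s+1)(2a+b)/(2N₀)| ≤ ε`, and ONE smallness condition `256(ρ+2)² + 3ε + 3 ≤ β²N₀` on the real radius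
`ρ ≥ 0`: for every real centre `m`, `(ρ²/2)·law_{univ}(2s+1,1;x) ≤ A^m_1(x)`. So `cV = ρ²/2` with any
`ρ ≤ β√N₀/16 − 2 − √(3ε+3)/16`, i.e. `√cV ≍ β√N₀` in the window `ε ≍ √N₀·polylog ≪ β²N₀` — asymptotically, as
every constant on this line. [cite: Rothvoss2017, §2 (PDF p. 6)] [cite: ChattamvelliShanmugam2020, §7.4 (PDF p. 144)] -/
theorem centredSq_law_ge_of_typeMargins' (H : Finset (Fin n)) {a b d N₀ : ℕ}
    (ha : (reps π (vAA π univ H)).card = a) (hb : (reps π (vBH π univ H ∪ vBN π univ H)).card = b)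
    (hd : (reps π (vDD π univ H)).card = d) (hN : a + b + d = N₀)
    {β : ℝ} (hβ : 0 < β) (hβ4 : β ≤ 1 / 4)
    (haβ : β * N₀ + 1 ≤ a) (hbβ : β * N₀ + 1 ≤ b) (hdβ : β * N₀ + 1 ≤ d)
    {s : ℕ} (hs : β * N₀ ≤ s) (hs' : 8 * (s : ℝ) ≤ (4 + β) * N₀)
    {x : ℕ} {ε : ℝ} (hx : |(x : ℝ) - (2 * s + 1) * (2 * a + b) / (2 * (N₀ : ℝ))| ≤ ε)
    {ρ : ℝ} (hρ : 0 ≤ ρ) (hsmall : 256 * (ρ + 2) ^ 2 + 3 * ε + 3 ≤ β ^ 2 * N₀) (m : ℝ) :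
    (ρ ^ 2 / 2) * shellLaw π univ H (2 * s + 1) 1 (x : ℤ) ≤
      (∑ U ∈ (shell π (2 * s + 1) 1).filter (fun U => ((U ∩ H).card : ℤ) = (x : ℤ)),
          (((((reps π (vAA π univ H)).filter fun v => v ∈ U ∧ π v ∈ U).card : ℕ) : ℝ) - m) ^ 2) /
        ((shell π (2 * s + 1) 1).card : ℝ) := by
  have hε : 0 ≤ ε := (abs_nonneg _).trans hx
  have hN0 : (0 : ℝ) ≤ N₀ := Nat.cast_nonneg _
  have hβN0 : 0 ≤ β * N₀ := mul_nonneg hβ.le hN0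
  -- `β²N₀ ≥ 1027` forces `βN₀ ≥ 1024` and `N₀ ≥ 4096`
  have h1027 : (1027 : ℝ) ≤ β ^ 2 * N₀ := by nlinarith only [hsmall, hε, hρ, sq_nonneg ρ]
  have hβN : 1024 ≤ β * N₀ := by nlinarith only [h1027, hβ4, hβN0]
  have hN8 : (4096 : ℝ) ≤ N₀ := by nlinarith only [hβN, hβ4, hN0]
  have hmul : ∀ {e : ℕ}, β * N₀ + 1 ≤ (e : ℝ) → 256 * (ρ + 2) ^ 2 + 3 * ε + 3 ≤ β * ((e : ℝ) - 1) := by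
    intro e he
    have : β * (β * N₀) ≤ β * ((e : ℝ) - 1) := mul_le_mul_of_nonneg_left (by linarith only [he]) hβ.le
    nlinarith only [this, hsmall]
  refine centredSq_law_ge_of_typeMargins hπ hπ' H ha hb hd hN hβ ?_ ?_ hx hρ (hmul haβ) (hmul hbβ) (hmul hdβ) m
  · linarith only [hs, hβ]
  · nlinarith only [hs', hβ4, hβ, hN8, hβN, hN0]

/-! ### §10 (v9) The smallness condition in the cell's scale `N₀ = P⁸`

Usage notes for `centredSq_law_ge_of_typeMargins'` (pure real arithmetic): with the radius `ρ = √2·c·P⁴` one has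
`√(ρ²/2) = c·P⁴` — the root form `c_r·P⁴ ≤ √cV` in which the Summits-side numerics (brick 140b
`epsBC_numerics`) consume the variance floor — and with `c = β/32` and ANY window `ε ≤ c_ε·P⁷` the smallness
condition `256(ρ+2)² + 3ε + 3 ≤ β²P⁸` holds for `P ≥ P* = 300/β + 6200/β² + 18c_ε/β²`. -/

omit hπ hπ' in
/-- `√((√2·c·P⁴)²/2) = c·P⁴` for `c ≥ 0` (any real `P`): the radius `ρ = √2·c·P⁴` realises `√cV = c·P⁴` for
`cV = ρ²/2`. [cite: ChattamvelliShanmugam2020, §7.4 (PDF p. 144)] -/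
theorem sqrt_half_sq_radius {c : ℝ} (P : ℝ) (hc : 0 ≤ c) :
    Real.sqrt ((Real.sqrt 2 * c * P ^ 4) ^ 2 / 2) = c * P ^ 4 := by
  have hs2 : Real.sqrt 2 ^ 2 = 2 := Real.sq_sqrt (by norm_num)
  have e : (Real.sqrt 2 * c * P ^ 4) ^ 2 / 2 = (c * P ^ 4) ^ 2 := by rw [mul_pow, mul_pow, hs2]; ring
  rw [e, Real.sqrt_sq (by positivity)]

omit hπ hπ' in
/-- **The smallness condition of `centredSq_law_ge_of_typeMargins'` in the scale `N₀ = P⁸`.** For `0 < β`,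
`0 ≤ c_ε` and `P ≥ P* = 300/β + 6200/β² + 18c_ε/β²`, `P ≥ 1`: every window half-width `0 ≤ ε ≤ c_ε·P⁷` and the
radius `ρ = √2·(β/32)·P⁴` satisfy `256(ρ+2)² + 3ε + 3 ≤ β²·P⁸` (so `cV = ρ²/2 = (β/32)²·P⁸`, `√cV = (β/32)·P⁴`).
(`256ρ² = (β²/2)P⁸`; the three other terms `32√2·βP⁴ ≤ 48βP⁴`, `1027`, `3c_εP⁷` are each `≤ (β²/6)P⁸`.)
[cite: ChattamvelliShanmugam2020, §7.4 (PDF p. 144)] -/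
theorem typeMargins_smallness_of_scale {β cε : ℝ} (hβ : 0 < β) (hcε : 0 ≤ cε) :
    ∃ Pstar : ℝ, 0 ≤ Pstar ∧ ∀ P : ℝ, Pstar ≤ P → 1 ≤ P → ∀ ε : ℝ, 0 ≤ ε → ε ≤ cε * P ^ 7 →
      256 * (Real.sqrt 2 * (β / 32) * P ^ 4 + 2) ^ 2 + 3 * ε + 3 ≤ β ^ 2 * P ^ 8 := by
  have hβ2 : 0 < β ^ 2 := by positivity
  refine ⟨300 / β + 6200 / β ^ 2 + 18 * cε / β ^ 2, by positivity, ?_⟩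
  intro P hP hP1 ε hε0 hε
  have hP0 : 0 ≤ P := by linarith only [hP1]
  have h300 : 0 ≤ 300 / β := by positivity
  have h6200 : 0 ≤ 6200 / β ^ 2 := by positivity
  have h18 : 0 ≤ 18 * cε / β ^ 2 := by positivity
  -- the three scale facts `βP ≥ 300`, `β²P ≥ 6200`, `β²P ≥ 18c_ε`
  have hPβ : 300 ≤ β * P := by
    have h1 : 300 / β ≤ P := by linarith only [hP, h6200, h18]
    rw [div_le_iff₀ hβ] at h1; linarith only [h1]
  have hPβ2 : 6200 ≤ β ^ 2 * P := by
    have h1 : 6200 / β ^ 2 ≤ P := by linarith only [hP, h300, h18]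
    rw [div_le_iff₀ hβ2] at h1; linarith only [h1]
  have hPc : 18 * cε ≤ β ^ 2 * P := by
    have h1 : 18 * cε / β ^ 2 ≤ P := by linarith only [hP, h300, h6200]
    rw [div_le_iff₀ hβ2] at h1; linarith only [h1]
  have hP4 : P ≤ P ^ 4 := le_self_pow₀ hP1 (by norm_num)
  have hP8 : P ≤ P ^ 8 := le_self_pow₀ hP1 (by norm_num)
  -- (1) the cross term
  have hA : 48 * β * P ^ 4 ≤ β ^ 2 / 6 * P ^ 8 := by
    have h1 : 300 ≤ β * P ^ 4 := hPβ.trans (mul_le_mul_of_nonneg_left hP4 hβ.le)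
    have h2 : 0 ≤ β * P ^ 4 := by positivity
    have e : β ^ 2 / 6 * P ^ 8 = (β * P ^ 4) * (β * P ^ 4) / 6 := by ring
    rw [e]; nlinarith only [h1, h2]
  -- (2) the constant term
  have hB : (1027 : ℝ) ≤ β ^ 2 / 6 * P ^ 8 := by
    have : β ^ 2 * P ≤ β ^ 2 * P ^ 8 := mul_le_mul_of_nonneg_left hP8 hβ2.le
    linarith only [hPβ2, this]
  -- (3) the window term
  have hC : 3 * ε ≤ β ^ 2 / 6 * P ^ 8 := by
    have h2 : 18 * cε * P ^ 7 ≤ β ^ 2 * P * P ^ 7 := mul_le_mul_of_nonneg_right hPc (by positivity)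
    have e : β ^ 2 * P * P ^ 7 = β ^ 2 * P ^ 8 := by ring
    linarith only [hε, h2, e]
  -- the square expanded; `√2 ≤ 3/2`
  have hs2 : Real.sqrt 2 ^ 2 = 2 := Real.sq_sqrt (by norm_num)
  have hs2' : Real.sqrt 2 ≤ 3 / 2 := by
    have h := Real.sqrt_le_sqrt (show (2 : ℝ) ≤ (3 / 2) ^ 2 by norm_num)
    rwa [Real.sqrt_sq (by norm_num)] at h
  have hsq : (Real.sqrt 2 * (β / 32) * P ^ 4 + 2) ^ 2 =
      2 * (β / 32) ^ 2 * P ^ 8 + 4 * (Real.sqrt 2 * (β / 32) * P ^ 4) + 4 := by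
    have : (Real.sqrt 2 * (β / 32) * P ^ 4) ^ 2 = 2 * (β / 32) ^ 2 * P ^ 8 := by
      rw [mul_pow, mul_pow, hs2]; ring
    rw [add_sq, this]; ring
  have hD : Real.sqrt 2 * (β / 32) * P ^ 4 ≤ (3 / 2) * ((β / 32) * P ^ 4) := by
    have : 0 ≤ (β / 32) * P ^ 4 := by positivity
    calc Real.sqrt 2 * (β / 32) * P ^ 4 = Real.sqrt 2 * ((β / 32) * P ^ 4) := by ring
      _ ≤ (3 / 2) * ((β / 32) * P ^ 4) := mul_le_mul_of_nonneg_right hs2' this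
  rw [hsq]
  linarith only [hA, hB, hC, hD, hε0]

/-! ### §11 (v10) (V) in the scale `N₀ = P⁸` with `cV = (β/32)²·P⁸` literally -/

omit hπ hπ' in
/-- `(√2·c·P⁴)²/2 = c²·P⁸` — with the radius `ρ = √2·c·P⁴`, `cV = ρ²/2` IS `c²·P⁸` (the form `c_r²·P⁸ ≤ V` of
the Summits-side `ε_A` numerics, as an equality). [cite: ChattamvelliShanmugam2020, §7.4 (PDF p. 144)] -/
theorem half_sq_radius_eq (c P : ℝ) : (Real.sqrt 2 * c * P ^ 4) ^ 2 / 2 = c ^ 2 * P ^ 8 := by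
  have hs2 : Real.sqrt 2 ^ 2 = 2 := Real.sq_sqrt (by norm_num)
  rw [mul_pow, mul_pow, hs2]; ring

/-- **(V) IN THE CELL'S SCALE, `cV = (β/32)²·P⁸` LITERALLY.** The primed turnkey
`centredSq_law_ge_of_typeMargins'` at the radius `ρ = √2·(β/32)·P⁴` with `N₀ = P⁸`: under the standard
hypothesis pack (`0 < β ≤ 1/4`, `βN₀+1 ≤ a, b, d`, `βN₀ ≤ s`, `8s ≤ (4+β)N₀`, the cell's window
`|x − (2s+1)(2a+b)/(2N₀)| ≤ ε`) and the smallness condition of `typeMargins_smallness_of_scale` at `(P, ε)`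
(`256(√2(β/32)P⁴ + 2)² + 3ε + 3 ≤ β²P⁸`, true for `P ≥ P*`, `0 ≤ ε ≤ c_ε P⁷`): for every real `m`,
`((β/32)²·P⁸) · law_{univ}(2s+1,1;x) ≤ (Σ_{U ∈ Shell(2s+1,1), |U∩H| = x} (n_A(U) − m)²)/|Shell(2s+1,1)|` — so the
assembly's `V := (β/32)²·P⁸` satisfies `c_r²·P⁸ ≤ V` with `c_r = β/32` by `le_rfl`.
[cite: Rothvoss2017, §2 (PDF p. 6)] [cite: ChattamvelliShanmugam2020, §7.4 (PDF p. 144)] -/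
theorem centredSq_law_ge_of_scale (H : Finset (Fin n)) {a b d N₀ : ℕ}
    (ha : (reps π (vAA π univ H)).card = a) (hb : (reps π (vBH π univ H ∪ vBN π univ H)).card = b)
    (hd : (reps π (vDD π univ H)).card = d) (hN : a + b + d = N₀)
    {β : ℝ} (hβ : 0 < β) (hβ4 : β ≤ 1 / 4)
    (haβ : β * N₀ + 1 ≤ a) (hbβ : β * N₀ + 1 ≤ b) (hdβ : β * N₀ + 1 ≤ d)
    {s : ℕ} (hs : β * N₀ ≤ s) (hs' : 8 * (s : ℝ) ≤ (4 + β) * N₀)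
    {x : ℕ} {ε : ℝ} (hx : |(x : ℝ) - (2 * s + 1) * (2 * a + b) / (2 * (N₀ : ℝ))| ≤ ε)
    {P : ℝ} (hN₀ : (N₀ : ℝ) = P ^ 8)
    (hsmall : 256 * (Real.sqrt 2 * (β / 32) * P ^ 4 + 2) ^ 2 + 3 * ε + 3 ≤ β ^ 2 * P ^ 8) (m : ℝ) :
    ((β / 32) ^ 2 * P ^ 8) * shellLaw π univ H (2 * s + 1) 1 (x : ℤ) ≤
      (∑ U ∈ (shell π (2 * s + 1) 1).filter (fun U => ((U ∩ H).card : ℤ) = (x : ℤ)),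
          (((((reps π (vAA π univ H)).filter fun v => v ∈ U ∧ π v ∈ U).card : ℕ) : ℝ) - m) ^ 2) /
        ((shell π (2 * s + 1) 1).card : ℝ) := by
  have hρ : 0 ≤ Real.sqrt 2 * (β / 32) * P ^ 4 := by positivity
  have hsmall' : 256 * (Real.sqrt 2 * (β / 32) * P ^ 4 + 2) ^ 2 + 3 * ε + 3 ≤ β ^ 2 * N₀ := by rwa [hN₀]
  have key := centredSq_law_ge_of_typeMargins' hπ hπ' H ha hb hd hN hβ hβ4 haβ hbβ hdβ hs hs' hx hρ hsmall' m
  rwa [half_sq_radius_eq] at key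

/-- **(V) in the cell's scale, `shellIn univ` spelling** (`centredSq_law_ge_of_scale` with the sum and the shell size
over `shellIn π univ (2s+1) 1`, the spelling of the `P₁`-style sections).
[cite: Rothvoss2017, §2 (PDF p. 6)] [cite: ChattamvelliShanmugam2020, §7.4 (PDF p. 144)] -/
theorem centredSq_law_ge_of_scale_shellIn (H : Finset (Fin n)) {a b d N₀ : ℕ}
    (ha : (reps π (vAA π univ H)).card = a) (hb : (reps π (vBH π univ H ∪ vBN π univ H)).card = b)
    (hd : (reps π (vDD π univ H)).card = d) (hN : a + b + d = N₀)
    {β : ℝ} (hβ : 0 < β) (hβ4 : β ≤ 1 / 4)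
    (haβ : β * N₀ + 1 ≤ a) (hbβ : β * N₀ + 1 ≤ b) (hdβ : β * N₀ + 1 ≤ d)
    {s : ℕ} (hs : β * N₀ ≤ s) (hs' : 8 * (s : ℝ) ≤ (4 + β) * N₀)
    {x : ℕ} {ε : ℝ} (hx : |(x : ℝ) - (2 * s + 1) * (2 * a + b) / (2 * (N₀ : ℝ))| ≤ ε)
    {P : ℝ} (hN₀ : (N₀ : ℝ) = P ^ 8)
    (hsmall : 256 * (Real.sqrt 2 * (β / 32) * P ^ 4 + 2) ^ 2 + 3 * ε + 3 ≤ β ^ 2 * P ^ 8) (m : ℝ) :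
    ((β / 32) ^ 2 * P ^ 8) * shellLaw π univ H (2 * s + 1) 1 (x : ℤ) ≤
      (∑ U ∈ (shellIn π univ (2 * s + 1) 1).filter (fun U => ((U ∩ H).card : ℤ) = (x : ℤ)),
          (((((reps π (vAA π univ H)).filter fun v => v ∈ U ∧ π v ∈ U).card : ℕ) : ℝ) - m) ^ 2) /
        ((shellIn π univ (2 * s + 1) 1).card : ℝ) := by
  rw [shellIn_univ_eq]
  exact centredSq_law_ge_of_scale hπ hπ' H ha hb hd hN hβ hβ4 haβ hbβ hdβ hs hs' hx hN₀ hsmall m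

end ShellStep

end Literature.Combinatorics.Optimization

end
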